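import Literature.NumberTheory.EllipticCurves.ZpExtensionShapiroToEisensteinShiftedSourceProofs
import Literature.NumberTheory.EllipticCurves.ZpExtensionShapiroToEisensteinBaseChange
import Literature.NumberTheory.EllipticCurves.ZpExtensionEisensteinDVRSettingLevelsTame
import Literature.NumberTheory.GaloisCohomology.Howard2004.TowerMorphismOfBaseChange
import HarnessLib

/-!
# THE pushforward morphism of tower settings `S_Λ.reindex σ → (T_𝔮, F_𝔮, 𝓛)`: Howard's Rem. 1.2.4 (iii) / proof of
# Thm. 2.2.10 («KS(𝐓, 𝓕_Λ, 𝓛) → KS(T_𝔭, 𝓕_𝔭, 𝓛)») for the curve, as ONE `CoeffTowerSetting.Hom` from lit's `Λ`-adic source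
# `shapiroSettingTame` (reindexed along an admissible `σ = idxSeq s₀ d`) into D1's `eisensteinDVRSettingLevelsTame`
# (definition with body + theorems)

Topic `NumberTheory/EllipticCurves` (sequel of `ZpExtensionShapiroToEisensteinShiftedSourceProofs` (G5a-2), `…ShiftedLocalConditionsProofs`
(G5a-1), `…ShapiroToEisensteinBaseChange` (G2), Howard's `TowerMorphismOfBaseChange` (G1: `Hom.ofBaseChange`), lit's
`ZpExtensionShapiroSetting` (A2) and D1's `ZpExtensionEisensteinDVRSettingLevelsTame`).  Cell `pub/bsd-print-x9`, seat `bsd-line-x9-p2` g4: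
STUB A (`stub_howardInputs`) of the shared μ-crux (`MuInequalityCoherentPairOfHoward`, skeleton v4) — the KS conjunct is
`KolyvaginSystem.ofHom (THIS Hom) ∘ KolyvaginSystem.reindex` applied to the (F-411) Kolyvagin system, and the LINK below.

* §1 (generic curve `V`, shifted tower): `cohomologyMap_shapiroToEisensteinLevelMap_succ_eq` (`H¹(f)` in the
  `ContinuousRep.cohomologyMap` spelling IS `galoisCohomology.map` of the intertwining map); for the curve,
  `WeierstrassCurve.isBaseChangeBy_shapiroToEisensteinLevelMap_succ` (G2 read on the shifted level: the level map
  `f_{i+1,k} : 𝐓_i → T_𝔮/p^k` presents `T_𝔮/p^k = 𝐓_i ⊗_{Λ/I} A_{m,k}`).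
* `Howard2004.tameSlotOn_localH1Map`: two guarded tame slots with the same guard are compatible along any locally equivariant
  map (the `fs_compat` field in the `localH1Map` currency; `TamePin.fs_natural` on the guard, `0 = 0` off it).
* §2 **`WeierstrassCurve.shapiroToEisensteinHom`** `: CoeffTowerSetting.Hom (Λ ↠ S_m) (S_Λ.reindex s₀ d) (eisensteinDVRSettingLevelsTame …)`
  := `Hom.ofBaseChange` with `f k := shapiroToEisensteinLevelMap (σ k + 1) (k+1)`, `φ_k := shapiroToEisensteinCoeff`; its
  hypotheses: the SAME `κ, π, S, 𝓛, jbar` on both sides, the source guard `P n v := n ∈ 𝓝(𝓛) ∧ v ∈ n` (= the target's, so the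
  finite–singular slots are compatible verbatim), an admissible index sequence `hadm` (`exists_idxSeq_adm`), the (N1) local torsion
  bound `hS` at `S ∖ {p}` (x9-p1-w4 g5), and `𝓛 ⊆ 𝓛₀` of both towers (`hL`, `hLt`).  Fields: `f_smul` (C11), `f_red` (G5a-2),
  `jbar_eq := rfl`, `primes_subset := id`, `cond_le` (G5a-1/2 = Howard Lemma 2.2.7), `fs_compat` (`tameSlotOn_localH1Map` on the
  common guard).  Unfoldings `shapiroToEisensteinHom_f` (`rfl`), `shapiroToEisensteinHom_fH1`.
* §3 **LINK** `shapiroToEisensteinHom_fH1_toShapiroSuccLimitH1`: at the twist `κ.unitTwist (-1)`,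
  `fH1 k ((Φ′ z)_{σ k}) = proj_{k+1} (toEisensteinH1 z)` — the bottom class of the pushforward of a Kolyvagin system with
  `κ₁ = Φ′(z)` is D1's compact control map at `z`, level by level.
DEFINITION WITH BODY + theorems; no named fact, no instance, no notation, no `sorry`.  BSD is not proved by any of this.

References: [Howard2004HeegnerKolyvagin] B. Howard, Compositio Math. 140 (2004), Rem. 1.2.4 (arXiv Rem. 2.2.4, p. 7 L13–27), Def. 1.2.3,
§1.6 (arXiv p. 11–12), Lemma 2.2.7, proof of Thm. 2.2.10 (arXiv p0017 L78–81); [CastellaGrossiLeeSkinner2022] §3.4, Thm. 4.1.1,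
Rem. 4.1.4; [SerreGaloisCohomology1997] I §2.2, II §6.1.
-/

noncomputable section

open scoped TensorProduct Topology Classical ContRepresentation
open Field CategoryTheory IsLocalRing IsDedekindDomain
open scoped NumberField

namespace Literature.NumberTheory.EllipticCurves.ZpExtension

open Literature.NumberTheory.GaloisRepresentations
open Literature.NumberTheory.GaloisCohomology.Howard2004

/-! ## §1 Base change and `H¹` of the level maps on the shifted tower -/

section Shifted

variable {K : Type} [Field K] [NumberField K] {V : WeierstrassCurve K} [V.IsElliptic] {p : ℕ} [hp : Fact p.Prime]
  (κ : ZpExtension K p)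
  (t : ∀ k, (V.torsionGaloisModule ((p : ℤ) ^ (k + 1))).toContRepresentation →ⁱL
    (V.torsionGaloisModule ((p : ℤ) ^ k)).toContRepresentation)
  (hts : ∀ k, Function.Surjective (t k)) {m : ℕ} (hm : 1 ≤ m)

omit [NumberField K] [V.IsElliptic] in
/-- **`H¹(f_{i+1,k})` is `galoisCohomology.map (shapiroToEisensteinTwistLe …) 1`** on the shifted tower (any equivariance proof):
the `Hom.fH1` of the pushforward computes by functoriality of the intertwining map.
[cite: SerreGaloisCohomology1997, I §2.2] [cite: Howard2004HeegnerKolyvagin, Rem. 1.2.4 (iii)] -/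
theorem cohomologyMap_shapiroToEisensteinLevelMap_succ_eq (i k : ℕ) (hσ : k ≤ i + 1)
    (hle : shapiroIdeal p (i + 1) ≤ Ideal.span {(PowerSeries.X ^ m + PowerSeries.C (p : ℤ_[p]) : IwasawaAlgebra p)} ⊔
      Ideal.span {PowerSeries.C ((p : ℤ_[p]) ^ k)})
    (h : ∀ (g : absoluteGaloisGroup K)
      (x : CoeffLevel p (fun j ↦ shapiroIdeal p (j + 1)) (fun j ↦ WeierstrassCurve.geomTorsion V ((p : ℤ) ^ (j + 1))) i),
      κ.shapiroToEisensteinLevelMap V hm (i + 1) k hσ hle ((κ.coeffAdicTower (fun j ↦ V.torsionGaloisModule ((p : ℤ) ^ (j + 1))) (fun j ↦ t (j + 1))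
      (fun j ↦ shapiroIdeal p (j + 1)) (fun j ↦ shapiroIdeal_succ_le p (j + 1)) (fun j ↦ j + 1) (fun j ↦ omega_mem_shapiroIdeal p (j + 1))
      (fun j ↦ (j + 1) * p ^ (j + 1) + (j + 1)) (fun j ↦ maximalIdeal_pow_le_shapiroIdeal p (j + 1)) (fun j ↦ hts (j + 1))).ρ i g x) =
        (κ.eisensteinTwist (V.torsionGaloisModule ((p : ℤ) ^ k)) hm k :
        ContinuousRep (absoluteGaloisGroup K) ℤ (EisensteinLevel p m (fun j ↦ WeierstrassCurve.geomTorsion V ((p : ℤ) ^ j)) k)) g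
          (κ.shapiroToEisensteinLevelMap V hm (i + 1) k hσ hle x)) :
    ContinuousRep.cohomologyMap ((κ.coeffAdicTower (fun j ↦ V.torsionGaloisModule ((p : ℤ) ^ (j + 1))) (fun j ↦ t (j + 1))
      (fun j ↦ shapiroIdeal p (j + 1)) (fun j ↦ shapiroIdeal_succ_le p (j + 1)) (fun j ↦ j + 1) (fun j ↦ omega_mem_shapiroIdeal p (j + 1))
      (fun j ↦ (j + 1) * p ^ (j + 1) + (j + 1)) (fun j ↦ maximalIdeal_pow_le_shapiroIdeal p (j + 1)) (fun j ↦ hts (j + 1))).ρ i)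
        (κ.eisensteinTwist (V.torsionGaloisModule ((p : ℤ) ^ k)) hm k :
        ContinuousRep (absoluteGaloisGroup K) ℤ (EisensteinLevel p m (fun j ↦ WeierstrassCurve.geomTorsion V ((p : ℤ) ^ j)) k))
        (κ.shapiroToEisensteinLevelMap V hm (i + 1) k hσ hle) continuous_of_discreteTopology h 1 =
      galoisCohomology.map (κ.shapiroToEisensteinTwistLe V hm (i + 1) k hσ hle) 1 := by
  refine AddMonoidHom.ext fun y ↦ ?_
  obtain ⟨φ, rfl⟩ := oneCocycleClass_surjective _ y
  change ContinuousCohomology.map _ _ 1 _ = ContinuousCohomology.map _ _ 1 _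
  erw [map_oneCocycleClass]

end Shifted

end Literature.NumberTheory.EllipticCurves.ZpExtension

/-! ### Guarded tame slots with a COMMON guard are compatible along any locally equivariant map -/

namespace Literature.NumberTheory.GaloisCohomology.Howard2004

open Literature.NumberTheory.GaloisRepresentations
open Literature.NumberTheory.GaloisRepresentations.DiscreteGaloisModule

variable {K : Type} [Field K] [NumberField K]
  {N : Finset (HeightOneSpectrum (𝓞 K)) → Type} [∀ n, AddCommGroup (N n)]
  [∀ n, TopologicalSpace (N n)] [∀ n, DiscreteTopology (N n)]
  {N' : Finset (HeightOneSpectrum (𝓞 K)) → Type} [∀ n, AddCommGroup (N' n)]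
  [∀ n, TopologicalSpace (N' n)] [∀ n, DiscreteTopology (N' n)]

/-- **Two guarded tame slots (lit g32's `tameSlotOn`) with THE SAME guard are compatible along every locally equivariant
additive map `r` of the modules**, in the `localH1Map` / `singularQuotientMap` currency of `Hom.fs_compat`: on the guard by the
naturality of Howard's finite–singular map in the module (`TamePin.fs_natural`), off the guard both slots vanish.
[cite: Howard2004HeegnerKolyvagin, Prop. 1.1.7 / Def. 1.1.8 and Def. 1.2.3 (arXiv p. 5 L129–149, p. 6 L126–131)] -/
theorem tameSlotOn_localH1Map [∀ n, Finite (N n)] [∀ n, Finite (N' n)]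
    (π : ∀ v : HeightOneSpectrum (𝓞 K), TamePin v)
    (ρq : ∀ n, DiscreteGaloisModule K (N n)) (ρq' : ∀ n, DiscreteGaloisModule K (N' n))
    (P : Finset (HeightOneSpectrum (𝓞 K)) → HeightOneSpectrum (𝓞 K) → Prop)
    (hP : ∀ n v, P n v → TameHyp ρq n v) (hP' : ∀ n v, P n v → TameHyp ρq' n v)
    (n : Finset (HeightOneSpectrum (𝓞 K))) (v : HeightOneSpectrum (𝓞 K)) (r : N n →+ N' n)
    (hr : ∀ (σ : absoluteGaloisGroup (v.adicCompletion K)) (x : N n),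
      r (GaloisRep.toLocal v (ρq n) σ x) = GaloisRep.toLocal v (ρq' n) σ (r x))
    (c : galoisCohomology (GaloisRep.toLocal v (ρq n)) 1) :
    tameSlotOn π ρq' P hP' n v (localH1Map (ρq n) (ρq' n) v r hr c) =
      TensorProduct.map (singularQuotientMap (ρq n) (ρq' n) v r hr).toIntLinearMap LinearMap.id
        (tameSlotOn π ρq P hP n v c) := by
  by_cases h : P n v
  · rw [tameSlotOn_eq_of π ρq P hP h, tameSlotOn_eq_of π ρq' P hP' h]
    exact (π v).fs_natural (ρq n) (ρq' n) r hr (hP n v h).1 (hP' n v h).1 (hP n v h).2 (hP' n v h).2 c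
  · rw [tameSlotOn_eq_zero_of π ρq P hP h, tameSlotOn_eq_zero_of π ρq' P hP' h]
    exact (map_zero (TensorProduct.map (singularQuotientMap (ρq n) (ρq' n) v r hr).toIntLinearMap
      (LinearMap.id (R := ℤ) (M := Gell v)))).symm

end Literature.NumberTheory.GaloisCohomology.Howard2004

/-! ## §2 The morphism of tower settings -/

namespace WeierstrassCurve

open Literature.NumberTheory.EllipticCurves Literature.NumberTheory.GaloisRepresentations
open Literature.NumberTheory.GaloisRepresentations.DiscreteGaloisModule
open Literature.NumberTheory.GaloisCohomology.Howard2004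
open Literature.NumberTheory.EllipticCurves.ZpExtension

variable {K : Type} [Field K] [NumberField K] (W : WeierstrassCurve ℚ) [W.IsElliptic] {p : ℕ} [hp : Fact p.Prime]
  (κ : ZpExtension K p) {m : ℕ} (hm : 1 ≤ m)
  (π : ∀ v : HeightOneSpectrum (𝓞 K), TamePin v)
  (S : Finset (HeightOneSpectrum (𝓞 K)))
  (hpS : ∀ v : HeightOneSpectrum (𝓞 K), ((p : ℕ) : 𝓞 K) ∈ v.asIdeal → v ∈ S)
  (hbad : ∀ v : HeightOneSpectrum (𝓞 K), v ∉ S → ((p : ℕ) : 𝓞 K) ∉ v.asIdeal → (W.baseChange K).HasGoodReductionAt v)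
  (L : Set (HeightOneSpectrum (𝓞 K))) (hL : L ⊆ (W.shapiroTower K p κ).degreeTwoPrimes p)
  (hLt : letI := IwasawaAlgebra.isLocalRing_quotient_X_pow_add_C p hm
    L ⊆ (W.eisensteinTower κ hm).degreeTwoPrimes p)
  (hLS : ∀ v ∈ L, v ∉ S)
  (jbar : AlgebraicClosure K →+* ℂ) (cd : ConjugationDatum K)
  (πbar : letI := W.shapiroResidueModule K p
    ∀ j, W.ShapiroLevel K p j →ₗ[IwasawaAlgebra p ⧸ shapiroIdeal p (j + 1)] geomTorsion (W.baseChange K) (p : ℤ))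
  (D : ∀ j, DualityDatum p cd ((W.shapiroTower K p κ).ρ j) (IwasawaAlgebra p ⧸ shapiroIdeal p (j + 1)))
  (cdt : ConjugationDatum K)
  (Dt : letI := IwasawaAlgebra.isLocalRing_quotient_X_pow_add_C p hm
    ∀ k, DualityDatum p cdt ((W.eisensteinTower κ hm).ρ k) (IwasawaAlgebra.EisensteinCoeff p m (k + 1)))
  (s₀ : ℕ) (d : ℕ → ℕ)
  (hadm : ∀ k σ, idxSeq s₀ d k + 1 ≤ σ → k + 1 ≤ σ ∧
    shapiroIdeal p σ ≤ Ideal.span {(PowerSeries.X ^ m + PowerSeries.C (p : ℤ_[p]) : IwasawaAlgebra p)} ⊔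
      Ideal.span {PowerSeries.C ((p : ℤ_[p]) ^ (k + 1))})
  (hS : ∀ v ∈ S, ((p : ℕ) : 𝓞 K) ∉ v.asIdeal → ∃ c : ℕ, ∀ i, 1 ≤ i → ∀ x : galoisCohomology
    ((κ.eisensteinTwist ((W.baseChange K).torsionGaloisModule ((p : ℤ) ^ i)) hm i).toLocal (Sum.inr v)) 1, p ^ c • x = 0)

set_option synthInstance.maxHeartbeats 80000 in
/-- **`T_𝔮/p^k = 𝐓_i ⊗_{Λ/(ω_{i+1},p^{i+1})} A_{m,k}` along `f_{i+1,k}`** on lit's shifted tower of the curve (G2's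
`isBaseChangeBy_shapiroToEisensteinLevelMap` at Shapiro level `i+1`, read on tower level `i`).
[cite: Howard2004HeegnerKolyvagin, Rem. 1.2.4 and proof of Thm. 2.2.10 (arXiv p. 7 L13–27, p. 17 L78–81)] -/
theorem isBaseChangeBy_shapiroToEisensteinLevelMap_succ (i k : ℕ) (hσ : k ≤ i + 1)
    (hle : shapiroIdeal p (i + 1) ≤ Ideal.span {(PowerSeries.X ^ m + PowerSeries.C (p : ℤ_[p]) : IwasawaAlgebra p)} ⊔
      Ideal.span {PowerSeries.C ((p : ℤ_[p]) ^ k)}) :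
    IsBaseChangeBy ((W.shapiroTower K p κ).ρ i) (shapiroToEisensteinCoeff p (m := m) hle)
      (κ.eisensteinTwist ((W.baseChange K).torsionGaloisModule ((p : ℤ) ^ k)) hm k :
        ContinuousRep (absoluteGaloisGroup K) ℤ (EisensteinLevel p m (fun j ↦ geomTorsion (W.baseChange K) ((p : ℤ) ^ j)) k))
      (κ.shapiroToEisensteinLevelMap (W.baseChange K) hm (i + 1) k hσ hle) where
  ringHom_surjective := shapiroToEisensteinCoeff_surjective p hle
  surjective := κ.shapiroToEisensteinTwistLe_surjective hm (i + 1) k hσ hle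
    ((W.baseChange K).torsionGaloisModulePowReduce_surjective p (i + 1) k hσ)
  map_smul r x := κ.shapiroToEisensteinTwistLe_smul hm (i + 1) k hσ hle r
    (x : QuotTwisted (IwasawaAlgebra p ⧸ shapiroIdeal p (i + 1)) (geomTorsion (W.baseChange K) ((p : ℤ) ^ (i + 1))))
  ker_le x hx := κ.mem_ker_smul_top_of_shapiroToEisensteinTwistLe_eq_zero hm (i + 1) k hσ hle
    (x := (x : QuotTwisted (IwasawaAlgebra p ⧸ shapiroIdeal p (i + 1)) (geomTorsion (W.baseChange K) ((p : ℤ) ^ (i + 1))))) hx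
  equivariant g x := congrArg
    (fun φ ↦ φ (x : QuotTwisted (IwasawaAlgebra p ⧸ shapiroIdeal p (i + 1)) (geomTorsion (W.baseChange K) ((p : ℤ) ^ (i + 1)))))
    ((κ.shapiroToEisensteinTwistLe (W.baseChange K) hm (i + 1) k hσ hle).isIntertwining' g)

/-! ### The level maps `f k := f_{σ(k)+1, k+1}` of the pushforward and their four compatibilities -/

/-- **The level maps of the pushforward** `f k := f_{σ(k)+1, k+1} : 𝐓_{σ k} → T_𝔮/p^{k+1}` (C11's `shapiroToEisensteinLevelMap` at the
admissible pair `(σ(k)+1, k+1)`), on lit's level synonym `ShapiroLevel (σ k)` and D1's `EisensteinLevel … (k+1)`.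
[cite: Howard2004HeegnerKolyvagin, Rem. 1.2.4 (arXiv p. 7, L13–27)] -/
def shapiroToEisensteinHomF (k : ℕ) :
    W.ShapiroLevel K p (idxSeq s₀ d k) →+ EisensteinLevel p m (fun j ↦ geomTorsion (W.baseChange K) ((p : ℤ) ^ j)) (k + 1) :=
  κ.shapiroToEisensteinLevelMap (W.baseChange K) hm (idxSeq s₀ d k + 1) (k + 1) (hadm k _ le_rfl).1 (hadm k _ le_rfl).2

omit [W.IsElliptic] in
/-- Unfolding `shapiroToEisensteinHomF`. [cite: Howard2004HeegnerKolyvagin, Rem. 1.2.4] -/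
theorem shapiroToEisensteinHomF_eq (k : ℕ) :
    W.shapiroToEisensteinHomF κ hm s₀ d hadm k =
      κ.shapiroToEisensteinLevelMap (W.baseChange K) hm (idxSeq s₀ d k + 1) (k + 1) (hadm k _ le_rfl).1 (hadm k _ le_rfl).2 :=
  rfl

/-- `hbc` of `Hom.ofBaseChange` for the level maps: `T_𝔮/p^{k+1} = 𝐓_{σ k} ⊗ A_{m,k+1}` along `f k`.
[cite: Howard2004HeegnerKolyvagin, Rem. 1.2.4 (arXiv p. 7, L13–27)] -/
theorem isBaseChangeBy_shapiroToEisensteinHomF (k : ℕ) :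
    IsBaseChangeBy ((W.shapiroTower K p κ).ρ (idxSeq s₀ d k)) (shapiroToEisensteinCoeff p (m := m) (hadm k _ le_rfl).2)
      (κ.eisensteinTwist ((W.baseChange K).torsionGaloisModule ((p : ℤ) ^ (k + 1))) hm (k + 1) :
        ContinuousRep (absoluteGaloisGroup K) ℤ (EisensteinLevel p m (fun j ↦ geomTorsion (W.baseChange K) ((p : ℤ) ^ j)) (k + 1)))
      (W.shapiroToEisensteinHomF κ hm s₀ d hadm k) :=
  W.isBaseChangeBy_shapiroToEisensteinLevelMap_succ κ hm (idxSeq s₀ d k) (k + 1) (hadm k _ le_rfl).1 (hadm k _ le_rfl).2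

omit [W.IsElliptic] in
/-- `f_smul`: `f k (g • x) = [g]_{S_m} • f k x`. [cite: Howard2004HeegnerKolyvagin, Rem. 1.2.4 (i) (arXiv p. 7, L13–17)] -/
theorem shapiroToEisensteinHomF_smul (k : ℕ) (g : IwasawaAlgebra p) (x : W.ShapiroLevel K p (idxSeq s₀ d k)) :
    W.shapiroToEisensteinHomF κ hm s₀ d hadm k (g • x) =
      (Ideal.Quotient.mk (Ideal.span {(PowerSeries.X ^ m + PowerSeries.C (p : ℤ_[p]) : IwasawaAlgebra p)})) g • W.shapiroToEisensteinHomF κ hm s₀ d hadm k x :=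
  κ.shapiroToEisensteinLevelMap_smul hm (idxSeq s₀ d k + 1) (k + 1) (hadm k _ le_rfl).1 (hadm k _ le_rfl).2 g x

/-- `f_red`: `f k ∘ red_k = red′_k ∘ f (k+1)` for the reindexed source (`red = redIter (σ k) (d k)`) and D1's target.
[cite: Howard2004HeegnerKolyvagin, Rem. 1.2.4 (arXiv p. 7, L13–27) and §1.6 (arXiv p. 12, L29–33)] -/
theorem shapiroToEisensteinHomF_red (k : ℕ) (x : W.ShapiroLevel K p (idxSeq s₀ d (k + 1))) :
    letI := IwasawaAlgebra.isLocalRing_quotient_X_pow_add_C p hm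
    W.shapiroToEisensteinHomF κ hm s₀ d hadm k (((W.shapiroTower K p κ).reindex s₀ d).red k x) =
      (W.eisensteinTower κ hm).red k (W.shapiroToEisensteinHomF κ hm s₀ d hadm (k + 1) x) :=
  κ.shapiroToEisensteinLevelMap_coeffAdicTower_succ_redIter_eq_red (fun j ↦ (W.baseChange K).torsionGaloisModuleReduce p j)
    (fun _ _ ↦ rfl) (fun j ↦ (W.baseChange K).torsionGaloisModuleReduce_surjective p j) hm (idxSeq s₀ d k) (d k) k
    (hadm k _ le_rfl).1 (hadm (k + 1) _ le_rfl).1 (hadm k _ le_rfl).2 (hadm (k + 1) _ le_rfl).2 x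

include hS in
/-- `cond_le` (Howard's Lemma 2.2.7, G5a): `H¹(f k)` carries `𝓕_Λ` at tower level `σ k` into `F_𝔮` at triple level `k`, every place.
[cite: Howard2004HeegnerKolyvagin, Lemma 2.2.7 and Rem. 1.2.4 (ii) (arXiv p. 7 L13–27, p0016 L142–148)] -/
theorem shapiroToEisensteinHomF_cond_le (k : ℕ) (v : NumberField.Place K) :
    ((W.shapiroTowerTriple κ S hpS hbad L hL hLS (idxSeq s₀ d k)).cond v).map
      (ContinuousRep.cohomologyMap (((W.shapiroTower K p κ).ρ (idxSeq s₀ d k)).toLocal v)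
        ((κ.eisensteinTwist ((W.baseChange K).torsionGaloisModule ((p : ℤ) ^ (k + 1))) hm (k + 1) :
        ContinuousRep (absoluteGaloisGroup K) ℤ (EisensteinLevel p m (fun j ↦ geomTorsion (W.baseChange K) ((p : ℤ) ^ j)) (k + 1))).toLocal v)
        (W.shapiroToEisensteinHomF κ hm s₀ d hadm k) continuous_of_discreteTopology
        (fun _ x ↦ ((W.isBaseChangeBy_shapiroToEisensteinHomF κ hm s₀ d hadm) k).equivariant _ x) 1) ≤
      κ.eisensteinSelmerStructure (fun j ↦ (W.baseChange K).torsionGaloisModule ((p : ℤ) ^ j)) (fun j ↦ (W.baseChange K).torsionGaloisModuleReduce p j) hm S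
        (fun v _ ↦ (W.baseChange K).ordinaryFiltrationAt v (fun j ↦ (W.baseChange K).torsionGaloisModuleReduce p j)
          (fun _ _ ↦ rfl)) (k + 1) v :=
  W.map_shapiroTowerTriple_cond_le_eisensteinSelmerStructure κ S hpS hbad L hL hLS hm (idxSeq s₀ d k) (k + 1)
    (hadm k _ le_rfl).1 (hadm k _ le_rfl).2 hS v _

/-! ### The morphism -/

set_option synthInstance.maxHeartbeats 80000 in
/-- **THE pushforward `Hom` `(𝐓, 𝓕_Λ, 𝓛)_σ → (T_𝔮, F_𝔮, 𝓛)`** (Howard Rem. 1.2.4 (iii); proof of Thm. 2.2.10, first map): from lit's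
`Λ`-adic source `S_Λ = shapiroSettingTame …` with the tame slots on the guard `n ∈ 𝓝(𝓛) ∧ v ∈ n`, re-indexed along the admissible
`σ = idxSeq s₀ d` (`hadm`), into D1's Eisenstein DVR setting with the same `π, S, 𝓛, jbar` (`eisensteinDVRSettingLevelsTame`),
along `Λ ↠ S_m = Λ/(T^m + p)`: level maps `f k := f_{σ(k)+1, k+1}` (`shapiroToEisensteinHomF`), level ring maps
`φ_k : Λ/(ω_{σ(k)+1}, p^{σ(k)+1}) ↠ A_{m,k+1}` (`shapiroToEisensteinCoeff`), quotient maps pinned by `Hom.ofBaseChange` (G1); the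
four compatibilities are the theorems above.  Hypothesis beyond the data: `hS` = the (N1) local torsion bound at `S ∖ {p}`.
[cite: Howard2004HeegnerKolyvagin, Rem. 1.2.4 (arXiv Rem. 2.2.4, p. 7 L13–27), Lemma 2.2.7 and proof of Thm. 2.2.10 (arXiv p0017 L78–81)] [cite: CastellaGrossiLeeSkinner2022, §3.4 and Thm. 4.1.1] -/
def shapiroToEisensteinHom :
    letI := IwasawaAlgebra.isDomain_quotient_X_pow_add_C p hm
    letI := IwasawaAlgebra.isDiscreteValuationRing_quotient_X_pow_add_C p hm
    haveI := IwasawaAlgebra.EisensteinCoeff.isLocalRing_succ p hm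
    letI := IwasawaAlgebra.EisensteinCoeff.algebraOfSpecSucc p m
    haveI := W.isScalarTower_algebraOfSpecSucc (K := K) (p := p) (m := m)
    letI := W.residueModuleSucc (K := K) (p := p) hm
    letI := W.shapiroResidueModule K p
    CoeffTowerSetting.Hom (Ideal.Quotient.mk (Ideal.span {(PowerSeries.X ^ m + PowerSeries.C (p : ℤ_[p]) : IwasawaAlgebra p)}))
      ((W.shapiroSettingTame κ π (fun n v ↦ n ∈ levels L ∧ v ∈ n)
        (W.shapiroTameHyp_of_mem_levels κ S hpS hbad L hL hLS) S hpS hbad L hL hLS jbar cd πbar D).reindex s₀ d)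
      (W.eisensteinDVRSettingLevelsTame κ hm π S hpS hbad L hLt hLS jbar cdt Dt).toCoeffTowerSetting :=
  letI := IwasawaAlgebra.isDomain_quotient_X_pow_add_C p hm
  letI := IwasawaAlgebra.isDiscreteValuationRing_quotient_X_pow_add_C p hm
  haveI := IwasawaAlgebra.EisensteinCoeff.isLocalRing_succ p hm
  letI := IwasawaAlgebra.EisensteinCoeff.algebraOfSpecSucc p m
  haveI := W.isScalarTower_algebraOfSpecSucc (K := K) (p := p) (m := m)
  letI := W.residueModuleSucc (K := K) (p := p) hm
  letI := W.shapiroResidueModule K p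
  CoeffTowerSetting.Hom.ofBaseChange
    ((W.shapiroSettingTame κ π (fun n v ↦ n ∈ levels L ∧ v ∈ n)
        (W.shapiroTameHyp_of_mem_levels κ S hpS hbad L hL hLS) S hpS hbad L hL hLS jbar cd πbar D).reindex s₀ d)
    (W.eisensteinDVRSettingLevelsTame κ hm π S hpS hbad L hLt hLS jbar cdt Dt).toCoeffTowerSetting
    (W.shapiroToEisensteinHomF κ hm s₀ d hadm) (fun k ↦ shapiroToEisensteinCoeff p (m := m) (hadm k _ le_rfl).2)
    (W.isBaseChangeBy_shapiroToEisensteinHomF κ hm s₀ d hadm)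
    (W.shapiroToEisensteinHomF_smul κ hm s₀ d hadm) (W.shapiroToEisensteinHomF_red κ hm s₀ d hadm) rfl (fun _ hv ↦ hv)
    (W.shapiroToEisensteinHomF_cond_le κ hm S hpS hbad L hL hLS s₀ d hadm hS)
    (fun k n v c _ ↦ by
      haveI := fun n ↦ W.finite_eisensteinLevelQuotCarrier (K := K) (p := p) κ hm k n
      haveI := fun n ↦ W.finite_shapiroLevelQuotCarrier (K := K) (p := p) κ (idxSeq s₀ d k) n
      exact tameSlotOn_localH1Map π _ _ (fun n v ↦ n ∈ levels L ∧ v ∈ n)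
        (W.shapiroTameHyp_of_mem_levels κ S hpS hbad L hL hLS (idxSeq s₀ d k))
        (W.eisensteinLevels_tameHyp κ hm S hpS hbad L hLt hLS k) n v _ _ c)

set_option synthInstance.maxHeartbeats 80000 in
/-- Unfolding: the level maps of the pushforward are `shapiroToEisensteinHomF` (= `f_{σ(k)+1, k+1}`).
[cite: Howard2004HeegnerKolyvagin, Rem. 1.2.4 (arXiv p. 7, L13–27)] -/
theorem shapiroToEisensteinHom_f (k : ℕ) :
    letI := IwasawaAlgebra.isDomain_quotient_X_pow_add_C p hm
    letI := IwasawaAlgebra.isDiscreteValuationRing_quotient_X_pow_add_C p hm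
    haveI := IwasawaAlgebra.EisensteinCoeff.isLocalRing_succ p hm
    letI := IwasawaAlgebra.EisensteinCoeff.algebraOfSpecSucc p m
    haveI := W.isScalarTower_algebraOfSpecSucc (K := K) (p := p) (m := m)
    letI := W.residueModuleSucc (K := K) (p := p) hm
    letI := W.shapiroResidueModule K p
    (W.shapiroToEisensteinHom κ hm π S hpS hbad L hL hLt hLS jbar cd πbar D cdt Dt s₀ d hadm hS).f k =
      W.shapiroToEisensteinHomF κ hm s₀ d hadm k :=
  rfl

set_option synthInstance.maxHeartbeats 80000 in
/-- Unfolding: `H¹` of the level maps of the pushforward is `galoisCohomology.map (shapiroToEisensteinTwistLe (σ k + 1) (k+1) …) 1`.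
[cite: SerreGaloisCohomology1997, I §2.2] [cite: Howard2004HeegnerKolyvagin, Rem. 1.2.4 (iii)] -/
theorem shapiroToEisensteinHom_fH1 (k : ℕ) :
    letI := IwasawaAlgebra.isDomain_quotient_X_pow_add_C p hm
    letI := IwasawaAlgebra.isDiscreteValuationRing_quotient_X_pow_add_C p hm
    haveI := IwasawaAlgebra.EisensteinCoeff.isLocalRing_succ p hm
    letI := IwasawaAlgebra.EisensteinCoeff.algebraOfSpecSucc p m
    haveI := W.isScalarTower_algebraOfSpecSucc (K := K) (p := p) (m := m)
    letI := W.residueModuleSucc (K := K) (p := p) hm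
    letI := W.shapiroResidueModule K p
    (W.shapiroToEisensteinHom κ hm π S hpS hbad L hL hLt hLS jbar cd πbar D cdt Dt s₀ d hadm hS).fH1 k =
      galoisCohomology.map (κ.shapiroToEisensteinTwistLe (W.baseChange K) hm (idxSeq s₀ d k + 1) (k + 1) (hadm k _ le_rfl).1
        (hadm k _ le_rfl).2) 1 :=
  κ.cohomologyMap_shapiroToEisensteinLevelMap_succ_eq (fun j ↦ (W.baseChange K).torsionGaloisModuleReduce p j)
    (fun j ↦ (W.baseChange K).torsionGaloisModuleReduce_surjective p j) hm (idxSeq s₀ d k) (k + 1)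
    (hadm k _ le_rfl).1 (hadm k _ le_rfl).2 _

/-! ## §3 The LINK: the pushforward's `H¹(f_k)` on `Φ′(z)` is D1's control map -/

section Link

variable {γ : absoluteGaloisGroup K} (Dsel : (W.baseChange K).LambdaAdicSelmerData κ γ)
  (hγ : κ.IsTopGenerator γ) (hE : ∀ P : (W.baseChange K).toAffine.Point, p • P = 0 → P = 0)

set_option synthInstance.maxHeartbeats 80000 in
/-- **LINK `fH1 k (Φ′ z)_{σ k} = proj_{k+1} (toEisensteinH1 z)`** for the pushforward at the twist `κ.unitTwist (-1)` (the twist of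
lit's `S_Λ` in (F-411) and of D1's target): the `k`-th class of `KolyvaginSystem.ofHom (shapiroToEisensteinHom …) (κ.reindex s₀ d)`
for a Kolyvagin system with `κ₁ = Φ′(z)` is the `(k+1)`-st projection of D1's compact control map at `z`.
[cite: Howard2004HeegnerKolyvagin, proof of Thm. 2.2.10 (arXiv p0017 L78–81)] [cite: CastellaGrossiLeeSkinner2022, Rem. 4.1.4] -/
theorem shapiroToEisensteinHom_fH1_toShapiroSuccLimitH1
    (hL' : L ⊆ (W.shapiroTower K p (κ.unitTwist (-1))).degreeTwoPrimes p)
    (hLt' : letI := IwasawaAlgebra.isLocalRing_quotient_X_pow_add_C p hm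
      L ⊆ (W.eisensteinTower (κ.unitTwist (-1)) hm).degreeTwoPrimes p)
    (πbar' : letI := W.shapiroResidueModule K p
      ∀ j, W.ShapiroLevel K p j →ₗ[IwasawaAlgebra p ⧸ shapiroIdeal p (j + 1)] geomTorsion (W.baseChange K) (p : ℤ))
    (D' : ∀ j, DualityDatum p cd ((W.shapiroTower K p (κ.unitTwist (-1))).ρ j) (IwasawaAlgebra p ⧸ shapiroIdeal p (j + 1)))
    (Dt' : letI := IwasawaAlgebra.isLocalRing_quotient_X_pow_add_C p hm
      ∀ k, DualityDatum p cdt ((W.eisensteinTower (κ.unitTwist (-1)) hm).ρ k) (IwasawaAlgebra.EisensteinCoeff p m (k + 1)))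
    (hS' : ∀ v ∈ S, ((p : ℕ) : 𝓞 K) ∉ v.asIdeal → ∃ c : ℕ, ∀ i, 1 ≤ i → ∀ x : galoisCohomology
      (((κ.unitTwist (-1)).eisensteinTwist ((W.baseChange K).torsionGaloisModule ((p : ℤ) ^ i)) hm i).toLocal (Sum.inr v)) 1,
      p ^ c • x = 0)
    (I : ZpExtension.EisensteinH1Data (κ.unitTwist (-1)) (fun k ↦ (W.baseChange K).torsionGaloisModule ((p : ℤ) ^ k))
      (fun j ↦ (W.baseChange K).torsionGaloisModuleReduce p j) hm)
    (k : ℕ) (z : Dsel.S) :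
    letI := IwasawaAlgebra.isDomain_quotient_X_pow_add_C p hm
    letI := IwasawaAlgebra.isDiscreteValuationRing_quotient_X_pow_add_C p hm
    haveI := IwasawaAlgebra.EisensteinCoeff.isLocalRing_succ p hm
    letI := IwasawaAlgebra.EisensteinCoeff.algebraOfSpecSucc p m
    haveI := W.isScalarTower_algebraOfSpecSucc (K := K) (p := p) (m := m)
    letI := W.residueModuleSucc (K := K) (p := p) hm
    letI := W.shapiroResidueModule K p
    (W.shapiroToEisensteinHom (κ.unitTwist (-1)) hm π S hpS hbad L hL' hLt' hLS jbar cd πbar' D' cdt Dt' s₀ d hadm hS').fH1 k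
        ((W.toShapiroSuccLimitH1 Dsel hγ hE z).1 (idxSeq s₀ d k)) =
      I.proj (k + 1) (Dsel.toEisensteinH1 hm (fun j ↦ (W.baseChange K).torsionGaloisModuleReduce p j) (fun _ _ ↦ rfl) I hγ hE z) := by
  rw [shapiroToEisensteinHom_fH1]
  exact W.map_shapiroToEisensteinTwistLe_toShapiroSuccLimitH1_eq_proj_toEisensteinH1 hm Dsel hγ hE I (idxSeq s₀ d k)
    (k + 1) (hadm k _ le_rfl).1 (hadm k _ le_rfl).2 z

end Link

end WeierstrassCurve

end
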